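import Literature.Analysis.FluidPDE.MollifiedPressurePoisson
import Literature.Analysis.FluidPDE.HessianLaplacianLp
import Literature.Analysis.FluidPDE.SereginSverakScaledEnergyProofs
import Literature.Analysis.FluidPDE.SereginSverakBlowupSelection
import HarnessLib

/-!
# Space–time tools for the decay estimate of the pressure (Seregin–Šverák 2009, (as13))

Analysis/FluidPDE support file on the decomposition path of the named fact
`Literature.Analysis.FluidPDE.SereginSverak2009.PressureDecay` (G. Seregin, V. Šverák, Comm. PDE
34 (2009) = arXiv:0804.1803, proof of Lemma 3.5, (as13):
`D(z_b, ϱ; q) ≤ c[(ϱ/r) D(z_b, r; q) + (r/ϱ)² C(z_b, r; v)]`). The proof of (as13) being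
assembled in the tree mollifies the distributional solution in space–time on the cylinder
`Q(z₀, r) = ]t₀ - r², t₀[ × 𝒞(x₀, r)` (`FluidPDE/SpaceTimeMollifier`, `MollifiedPressurePoisson`),
applies the fixed-scale Green/Calderón–Zygmund estimate slice by slice
(`FluidPDE/PressureGreenEstimate`) and integrates in time. This file collects the elementary
tools of that passage, all proved:

* geometry of the cylinders of Seregin–Šverák (`SereginSverak2009.parCyl`, `spaceCyl`):
  `closedBall_subset_parCyl_of_mem` — for `ϱ ≤ r/4`, times `t₀ - ϱ² < τ < t₀ - ρ`, points
  `x ∈ 𝒞(x₀, ϱ)`, `|z| ≤ r/2` and kernel radii `ρ ≤ min(r/4, r²/2)`, the space–time ball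
  `B̄((τ, x - z), ρ)` lies in `Q(z₀, r)` (so the mollified equations hold there); volume bounds
  `volume_spaceCyl_le`;
* compact support of the slices of a space–time mollification of a zero extension from a
  bounded set (`hasCompactSupport_stMollify_zeroExt_slice`);
* Tonelli in the form `∫_I ‖F(τ, ·)‖_{3/2}^{3/2} dτ ≤ ∫∫ |F|^{3/2}`
  (`setLIntegral_eLpNorm_slice_rpow_le`) and Young's inequality for normalised bump kernels
  combined with the zero extension, `∫∫ |k ⋆ 𝟙_Q f|^{3/2} ≤ ∫∫_Q |f|^{3/2}`
  (`lintegral_rpow_normed_convolution_zeroExt_le`);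
* the sup bound of the rescaled smoothing kernel `λ_{s/2,s} = s⁻³ λ_{1/2,1}(s⁻¹ ·)`
  (`exists_nnnorm_newtonFarLaplacian_half_le`) and the algebra `|uᵢuⱼ|^{3/2} ≤ |u|³`.

## References

* G. Seregin, V. Šverák, Comm. PDE 34 (2009) 171–201 = arXiv:0804.1803, §3 (the cylinders
  `Q(z₀, R)`, p. 9) and proof of Lemma 3.5, (as13) (p. 10). [`SereginSverak2009`]
* L. C. Evans, *Partial Differential Equations*, 2nd ed. (2010), App. C.4 (mollifiers).
  [`Evans2010`]
-/

noncomputable section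

open MeasureTheory TopologicalSpace Set Function Filter Topology Metric ContinuousLinearMap
open scoped ENNReal NNReal Convolution

namespace Literature.Analysis.FluidPDE

/-- Local notation for physical space `ℝ³ = EuclideanSpace ℝ (Fin 3)`. -/
local notation "ℝ³" => EuclideanSpace ℝ (Fin 3)

-- Lebesgue measure on space–time `ℝ × ℝ³` is an additive Haar measure: the tree's instance
-- (`FluidPDE/SpaceTimeMollifier`), activated locally.
attribute [local instance] instIsAddHaarMeasureVolumeSpaceTime

namespace SereginSverak2009

/-! ### Geometry of the cylinders -/

/-- A coordinate is bounded by the Euclidean norm: `|w₂| ≤ ‖w‖` on `ℝ³`. [folklore] -/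
theorem abs_apply_two_le_norm (w : ℝ³) : |w 2| ≤ ‖w‖ := by
  have h := norm_sq_eq_cylRadius_sq_add w
  have hc := sq_nonneg (cylRadius w)
  have h2 : (w 2) ^ 2 ≤ ‖w‖ ^ 2 := by nlinarith
  exact abs_le_of_sq_le_sq' h2 (norm_nonneg _) |> fun h' => abs_le.2 h'

/-- Enlarging a cylinder by a Euclidean displacement: if `x ∈ 𝒞(x₀, ϱ)` and `‖y - x‖ ≤ d` then
`y ∈ 𝒞(x₀, ϱ + d')` for every `d' > d` — here in the form used below, with strict room.
[folklore] -/
theorem mem_spaceCyl_of_norm_sub_le {x₀ x y : ℝ³} {ϱ d R : ℝ} (hx : x ∈ spaceCyl x₀ ϱ)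
    (hy : ‖y - x‖ ≤ d) (hR : ϱ + d ≤ R) : y ∈ spaceCyl x₀ R := by
  rw [mem_spaceCyl] at hx ⊢
  have hsplit : y - x₀ = (x - x₀) + (y - x) := by abel
  constructor
  · calc cylRadius (y - x₀) = cylRadius ((x - x₀) + (y - x)) := by rw [hsplit]
      _ ≤ cylRadius (x - x₀) + cylRadius (y - x) := cylRadius_add_le _ _
      _ ≤ cylRadius (x - x₀) + ‖y - x‖ := by gcongr; exact cylRadius_le_norm' _
      _ < ϱ + d := add_lt_add_of_lt_of_le hx.1 hy
      _ ≤ R := hR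
  · have h2 : (y - x₀) 2 = (x 2 - x₀ 2) + (y - x) 2 := by
      simp only [PiLp.sub_apply]; ring
    calc |y 2 - x₀ 2| = |(x 2 - x₀ 2) + (y - x) 2| := by rw [← h2]; rfl
      _ ≤ |x 2 - x₀ 2| + |(y - x) 2| := abs_add_le _ _
      _ ≤ |x 2 - x₀ 2| + ‖y - x‖ := by gcongr; exact abs_apply_two_le_norm _
      _ < ϱ + d := add_lt_add_of_lt_of_le hx.2 hy
      _ ≤ R := hR

/-- **Room for the kernel.** Let `0 < ϱ ≤ r/4` and let the kernel radius satisfy `0 < ρ`,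
`ρ ≤ r/4`, `ρ ≤ r²/2`. For times `t₀ - ϱ² < τ < t₀ - ρ`, points `x ∈ 𝒞(x₀, ϱ)` and displacements
`|z| ≤ r/2`, the closed space–time ball `B̄((τ, x - z), ρ)` (sup metric on `ℝ × ℝ³`) lies in the
parabolic cylinder `Q((t₀, x₀), r) = ]t₀ - r², t₀[ × 𝒞(x₀, r)` (time: `τ ± ρ ∈ ]t₀ - r², t₀[`
since `ϱ² + ρ ≤ r²/16 + r²/2 < r²`; space: `|x' - x₀'| + |z| + ρ < ϱ + r/2 + r/4 ≤ r`).
[cite: SereginSverak2009, §3 (the cylinders Q(z₀,R), arXiv p. 9)] -/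
theorem closedBall_subset_parCyl_of_mem {t₀ : ℝ} {x₀ : ℝ³} {r ϱ ρ τ : ℝ} (hr : 0 < r)
    (hϱr : ϱ ≤ r / 4) (hρ : 0 < ρ) (hρr : ρ ≤ r / 4) (hρr2 : ρ ≤ r ^ 2 / 2)
    (hτ : τ ∈ Ioo (t₀ - ϱ ^ 2) (t₀ - ρ)) {x : ℝ³} (hx : x ∈ spaceCyl x₀ ϱ) {z : ℝ³}
    (hz : ‖z‖ ≤ r / 2) :
    closedBall ((τ, x - z) : ℝ × ℝ³) ρ ⊆ parCyl ((t₀, x₀) : ℝ × ℝ³) r := by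
  intro w hw
  rw [mem_closedBall, Prod.dist_eq, max_le_iff, Real.dist_eq, dist_eq_norm] at hw
  have hϱ0 : 0 ≤ ϱ := by
    have := hx.1; have := cylRadius_nonneg (x - x₀); linarith
  have hϱ2 : ϱ ^ 2 ≤ r ^ 2 / 16 := by nlinarith
  rw [mem_parCyl]
  refine ⟨⟨?_, ?_⟩, ?_⟩
  · have := (abs_le.1 hw.1).1; have := hτ.1; simp only at this ⊢; nlinarith
  · have := (abs_le.1 hw.1).2; have := hτ.2; simp only at this ⊢; linarith
  · -- space: `w.2` is within `|z| + ρ ≤ r/2 + r/4` of `x ∈ 𝒞(x₀, ϱ)`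
    have hd : ‖w.2 - x‖ ≤ r / 2 + ρ := by
      calc ‖w.2 - x‖ = ‖(w.2 - (x - z)) + (-z)‖ := by congr 1; abel
        _ ≤ ‖w.2 - (x - z)‖ + ‖-z‖ := norm_add_le _ _
        _ ≤ ρ + r / 2 := by rw [norm_neg]; exact add_le_add hw.2 hz
        _ = r / 2 + ρ := add_comm _ _
    have hmem := mem_spaceCyl_of_norm_sub_le hx hd (R := r) (by linarith)
    exact (mem_spaceCyl.1 hmem)

/-- `|𝒞(x₀, ϱ)| ≤ (2ϱ)³ |B₁|` (`𝒞(x₀, ϱ) ⊆ B(x₀, 2ϱ)`). [folklore] -/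
theorem volume_spaceCyl_le (x₀ : ℝ³) {ϱ : ℝ} (hϱ : 0 < ϱ) :
    volume (spaceCyl x₀ ϱ) ≤ ENNReal.ofReal ((2 * ϱ) ^ 3) * volume (ball (0 : ℝ³) 1) := by
  calc volume (spaceCyl x₀ ϱ) ≤ volume (ball x₀ (2 * ϱ)) := measure_mono (spaceCyl_subset_ball _ _)
    _ = ENNReal.ofReal ((2 * ϱ) ^ 3) * volume (ball (0 : ℝ³) 1) := by
        rw [Measure.addHaar_ball volume x₀ (by positivity : (0 : ℝ) ≤ 2 * ϱ),
          finrank_euclideanSpace_fin]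

/-- `|B̄(0, s)| = s³ |B₁|` in `ℝ³`. [folklore] -/
theorem volume_closedBall_three {s : ℝ} (hs : 0 ≤ s) :
    volume (closedBall (0 : ℝ³) s) = ENNReal.ofReal (s ^ 3) * volume (ball (0 : ℝ³) 1) := by
  rw [Measure.addHaar_closedBall volume (0 : ℝ³) hs, finrank_euclideanSpace_fin]

end SereginSverak2009

/-! ### Compact support of the mollified zero extensions -/

section Support

variable {E : Type*} [NormedAddCommGroup E] [InnerProductSpace ℝ E] [FiniteDimensional ℝ E]
  [MeasurableSpace E] [BorelSpace E]
variable {F : Type*} [NormedAddCommGroup F] [NormedSpace ℝ F]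

omit [InnerProductSpace ℝ E] [FiniteDimensional ℝ E] [MeasurableSpace E] [BorelSpace E]
  [NormedSpace ℝ F] in
/-- Slices of compactly supported space–time fields are compactly supported (private copy of
the tree's `hasCompactSupport_slice_of_uncurry`, `FluidPDE/NSSuitableESSProofs`, not imported
here). [folklore] -/
private theorem hasCompactSupport_slice_of_uncurry' {f : ℝ → E → F}
    (h : HasCompactSupport (uncurry f)) (t : ℝ) : HasCompactSupport (f t) := by
  refine (h.image continuous_snd).of_isClosed_subset (isClosed_tsupport _) ?_
  refine closure_minimal (fun x hx => ⟨(t, x), subset_tsupport _ hx, rfl⟩)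
    (h.image continuous_snd).isClosed

omit [MeasurableSpace E] [BorelSpace E] [NormedSpace ℝ F] in
/-- The zero extension of a field from a bounded open set has compact support (private copy of
the tree's `hasCompactSupport_zeroExt`, `FluidPDE/NSSuitableESSProofs`). [folklore] -/
private theorem hasCompactSupport_zeroExt' {Q : Opens (ℝ × E)}
    (hQ : Bornology.IsBounded (Q : Set (ℝ × E))) (f : ℝ → E → F) :
    HasCompactSupport (zeroExt Q f) :=
  HasCompactSupport.intro' hQ.isCompact_closure isClosed_closure fun _ hz =>
    indicator_of_notMem (fun h => hz (subset_closure h)) _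

/-- **Slices of `k ⋆ 𝟙_Q f` are compactly supported** when the kernel `k` has compact support
and `Q` is bounded (`supp(k ⋆ g) ⊆ supp k + supp g`). [folklore] -/
theorem hasCompactSupport_stMollify_zeroExt_slice {Q : Opens (ℝ × E)}
    (hQ : Bornology.IsBounded (Q : Set (ℝ × E))) {k : ℝ × E → ℝ} (hkc : HasCompactSupport k)
    (f : ℝ → E → F) (t : ℝ) :
    HasCompactSupport (stMollify k (zeroExt Q f) t) := by
  refine hasCompactSupport_slice_of_uncurry' ?_ t
  rw [uncurry_stMollify]
  exact hkc.convolution _ (hasCompactSupport_zeroExt' hQ f)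

end Support

/-! ### Tonelli and Young for the exponent `3/2` -/

section Tonelli

variable {X : Type*} [NormedAddCommGroup X]

/-- `1 ≤ 3/2` in `ℝ≥0∞`. [folklore] -/
private theorem one_le_three_halves' : (1 : ℝ≥0∞) ≤ 3 / 2 := by
  rw [ENNReal.le_div_iff_mul_le (Or.inl (by norm_num)) (Or.inl (by norm_num)), one_mul]
  exact_mod_cast (by norm_num : (2 : ℕ) ≤ 3)

/-- `‖F(τ, ·)‖_{L^{3/2}(ℝ³)}^{3/2} = ∫ |F(τ, x)|^{3/2} dx`. [folklore] -/
theorem eLpNorm_three_halves_rpow_eq_lintegral {α : Type*} [MeasurableSpace α] (μ : Measure α)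
    (g : α → X) : eLpNorm g (3 / 2) μ ^ (3 / 2 : ℝ) = ∫⁻ x, ‖g x‖ₑ ^ (3 / 2 : ℝ) ∂μ := by
  have h := eLpNorm_nnreal_pow_eq_lintegral (f := g) (μ := μ) (p := (3 / 2 : ℝ≥0)) (by norm_num)
  have hc : ((3 / 2 : ℝ≥0) : ℝ≥0∞) = 3 / 2 := by
    rw [ENNReal.coe_div (by norm_num)]; norm_num
  have hr : ((3 / 2 : ℝ≥0) : ℝ) = 3 / 2 := by norm_num
  rw [hc, hr] at h
  exact h

/-- **Tonelli for slice norms**: for `F : ℝ × ℝ³ → X` a.e.-strongly measurable and any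
measurable set of times `I`, `∫_I ‖F(τ, ·)‖_{L^{3/2}}^{3/2} dτ ≤ ∫∫_{ℝ × ℝ³} |F|^{3/2}`.
[folklore] -/
theorem setLIntegral_eLpNorm_slice_rpow_le {F : ℝ × ℝ³ → X}
    (hF : AEStronglyMeasurable F (volume : Measure (ℝ × ℝ³))) (I : Set ℝ) :
    ∫⁻ τ in I, eLpNorm (fun x => F (τ, x)) (3 / 2) volume ^ (3 / 2 : ℝ) ≤
      ∫⁻ w, ‖F w‖ₑ ^ (3 / 2 : ℝ) := by
  have hmeas : AEMeasurable (uncurry fun τ x => ‖F (τ, x)‖ₑ ^ (3 / 2 : ℝ))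
      ((volume : Measure ℝ).prod (volume : Measure ℝ³)) := by
    have : (uncurry fun τ x => ‖F (τ, x)‖ₑ ^ (3 / 2 : ℝ)) = fun w => ‖F w‖ₑ ^ (3 / 2 : ℝ) := by
      funext w; rfl
    rw [this, ← Measure.volume_eq_prod]
    exact hF.enorm.pow_const _
  calc ∫⁻ τ in I, eLpNorm (fun x => F (τ, x)) (3 / 2) volume ^ (3 / 2 : ℝ)
      ≤ ∫⁻ τ, eLpNorm (fun x => F (τ, x)) (3 / 2) volume ^ (3 / 2 : ℝ) :=
        setLIntegral_le_lintegral _ _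
    _ = ∫⁻ τ, ∫⁻ x, ‖F (τ, x)‖ₑ ^ (3 / 2 : ℝ) := by
        refine lintegral_congr fun τ => ?_
        exact eLpNorm_three_halves_rpow_eq_lintegral volume fun x => F (τ, x)
    _ = ∫⁻ w, ‖F w‖ₑ ^ (3 / 2 : ℝ) := by
        rw [lintegral_lintegral hmeas, ← Measure.volume_eq_prod]

variable {E : Type*} [NormedAddCommGroup E] [InnerProductSpace ℝ E] [FiniteDimensional ℝ E]
  [MeasurableSpace E] [BorelSpace E] [NormedSpace ℝ X]

/-- **Young's inequality for the mollified zero extension**: for a normalised bump kernel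
`k = φ.normed` on `ℝ × E` and `f` a.e.-strongly measurable on the open set `Q`,
`∫∫ |k ⋆ 𝟙_Q f|^{3/2} ≤ ∫∫_Q |f|^{3/2}` (`‖k ⋆ g‖_{3/2} ≤ ‖g‖_{3/2}`, `‖k‖₁ = 1`). [folklore] -/
theorem lintegral_rpow_normed_convolution_zeroExt_le (φ : ContDiffBump (0 : ℝ × E))
    {Q : Opens (ℝ × E)} {f : ℝ → E → X}
    (hf : AEStronglyMeasurable (uncurry f) (volume.restrict (Q : Set (ℝ × E)))) :
    ∫⁻ w, ‖(φ.normed volume ⋆[lsmul ℝ ℝ, volume] zeroExt Q f) w‖ₑ ^ (3 / 2 : ℝ) ≤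
      ∫⁻ w in (Q : Set (ℝ × E)), ‖f w.1 w.2‖ₑ ^ (3 / 2 : ℝ) := by
  have hQm : MeasurableSet (Q : Set (ℝ × E)) := Q.isOpen.measurableSet
  have hg : AEStronglyMeasurable (zeroExt Q f) (volume : Measure (ℝ × E)) :=
    (aestronglyMeasurable_indicator_iff hQm).2 hf
  have hY := FunctionSpaces.eLpNorm_normed_convolution_le_haar (μ := (volume : Measure (ℝ × E)))
    φ hg one_le_three_halves'
  have hY' := ENNReal.rpow_le_rpow hY (by norm_num : (0 : ℝ) ≤ 3 / 2)
  rw [eLpNorm_three_halves_rpow_eq_lintegral, eLpNorm_three_halves_rpow_eq_lintegral] at hY'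
  refine hY'.trans_eq ?_
  -- `∫ |𝟙_Q f|^{3/2} = ∫_Q |f|^{3/2}`
  rw [← lintegral_indicator hQm]
  refine lintegral_congr fun w => ?_
  by_cases hw : w ∈ (Q : Set (ℝ × E))
  · rw [indicator_of_mem hw, zeroExt_of_mem _ hw]
  · rw [indicator_of_notMem hw, zeroExt_of_not_mem _ hw, enorm_zero,
      ENNReal.zero_rpow_of_pos (by norm_num)]

end Tonelli

/-! ### The rescaled smoothing kernel and the cubic bound -/

/-- **Sup bound of the rescaled smoothing kernel**: there is an absolute `M₁` with
`|λ_{s/2,s}(z)| ≤ M₁ s⁻³` for all `s > 0` and all `z` (`λ_{s/2,s} = s⁻³ λ_{1/2,1}(s⁻¹·)`,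
`newtonFarLaplacian_scale`, and `λ_{1/2,1}` is continuous with compact support). [folklore] -/
theorem exists_nnnorm_newtonFarLaplacian_half_le :
    ∃ M₁ : ℝ≥0, ∀ s : ℝ, 0 < s → ∀ z : ℝ³,
      ‖newtonFarLaplacian (s / 2) s z‖₊ ≤ M₁ * (s⁻¹ ^ 3).toNNReal := by
  obtain ⟨C, hC⟩ := (continuous_newtonFarLaplacian (by norm_num : (0 : ℝ) < 1 / 2)
    (by norm_num : (1 / 2 : ℝ) < 1)).bounded_above_of_compact_support
    (hasCompactSupport_newtonFarLaplacian (by norm_num : (0 : ℝ) ≤ 1 / 2) (by norm_num))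
  refine ⟨C.toNNReal, fun s hs z => ?_⟩
  have hscale : newtonFarLaplacian (s / 2) s z =
      s⁻¹ ^ 3 * newtonFarLaplacian (1 / 2) 1 (s⁻¹ • z) := by
    have := newtonFarLaplacian_scale hs (1 / 2) 1 z
    rwa [mul_one, show s * (1 / 2) = s / 2 by ring] at this
  have hs3 : 0 ≤ s⁻¹ ^ 3 := by positivity
  rw [← NNReal.coe_le_coe, coe_nnnorm, hscale, norm_mul, Real.norm_eq_abs, abs_of_nonneg hs3,
    NNReal.coe_mul, Real.coe_toNNReal _ hs3, mul_comm]
  gcongr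
  exact (hC _).trans (Real.le_coe_toNNReal C)

/-- **`|uᵢuⱼ|^{3/2} ≤ |u|³`** for the components `uᵢ = ⟪u, a⟫`, `|a|, |c| ≤ 1`, in `ℝ≥0∞`.
[folklore] -/
theorem enorm_inner_mul_inner_rpow_le {E : Type*} [NormedAddCommGroup E] [InnerProductSpace ℝ E]
    (v a c : E) (ha : ‖a‖ ≤ 1) (hc : ‖c‖ ≤ 1) :
    ‖(inner ℝ v a : ℝ) * inner ℝ v c‖ₑ ^ (3 / 2 : ℝ) ≤ ‖v‖ₑ ^ (3 : ℕ) := by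
  have h1 : ‖(inner ℝ v a : ℝ) * inner ℝ v c‖ ≤ ‖v‖ ^ 2 := by
    rw [norm_mul]
    calc ‖(inner ℝ v a : ℝ)‖ * ‖(inner ℝ v c : ℝ)‖ ≤ (‖v‖ * ‖a‖) * (‖v‖ * ‖c‖) :=
          mul_le_mul (norm_inner_le_norm _ _) (norm_inner_le_norm _ _) (norm_nonneg _)
            (by positivity)
      _ ≤ (‖v‖ * 1) * (‖v‖ * 1) := by gcongr
      _ = ‖v‖ ^ 2 := by ring
  have h2 : ‖(inner ℝ v a : ℝ) * inner ℝ v c‖ₑ ≤ ‖v‖ₑ ^ 2 := by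
    rw [← ofReal_norm, ← ofReal_norm, ← ENNReal.ofReal_pow (norm_nonneg _)]
    exact ENNReal.ofReal_le_ofReal h1
  calc ‖(inner ℝ v a : ℝ) * inner ℝ v c‖ₑ ^ (3 / 2 : ℝ) ≤ (‖v‖ₑ ^ 2) ^ (3 / 2 : ℝ) := by gcongr
    _ = ‖v‖ₑ ^ (3 : ℕ) := by
        rw [← ENNReal.rpow_natCast, ← ENNReal.rpow_mul, ← ENNReal.rpow_natCast]
        norm_num

end Literature.Analysis.FluidPDE

end
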